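import Literature.AlgebraicGeometry.Modules.ProjectiveFamilyTwistPushforward
import Literature.AlgebraicGeometry.Motives.GrassmannianClassifyEpi
import Literature.AlgebraicGeometry.Motives.GrassmannianQuotientIsoPullback
import Literature.AlgebraicGeometry.Modules.PullbackFlatMono
import Literature.AlgebraicGeometry.Modules.EpiOfFibrewiseSurjective
import Literature.AlgebraicGeometry.Motives.GrassmannianQuotientOfFreeModule
import HarnessLib

/-!
# A FLAT closed family `Z ⊂ 𝐏(ι; T)` defines a `T`-point of the Grassmannian of rank-`r` quotients
# (Mumford, *Curves on a surface*, Lect. 15 (II.)–(III.): «This is an `S`-valued point of the Grassmannian!»)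

Layer `Literature/AlgebraicGeometry/Motives`, namespace `Literature.AlgebraicGeometry.Motives`; THEOREMS ONLY (no `def`, no
instance, no notation, no named fact, no `sorry`).  Cell `hodgecm-mathlib` (D-0151), F-5 (5d-I) FILE β (director s232; censuses
B-p19 53f83eba §1–§2 S3–S4, B-p21 e4689c40 (D1), B-p09 bb4024e1).

SETTING (★ FILE α `Modules/ProjectiveFamilyTwistPushforward`): `T` locally Noetherian (universe `0`), `i : Z ⟶ 𝐏(ι; T)` a closed
immersion with `p_Z := i ≫ pr₁` FLAT, `𝒪_Z(d) := SerreTwist.twistMod (i ≫ pr₂) (unitModule Z) d`, `Q_d := (p_Z)_* 𝒪_Z(d)`; a free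
abelian group `M` with basis `b : J → M` (`J` finite) and global sections `q : J → Γ(Z, 𝒪_Z(d))` (e.g. the degree-`d` monomials).
HYPOTHESES at every field point `x : Spec K → T` (cartesian `X₀ = Z ×_T Spec K`, in the letters of ★ FILE B / ★ G10 / ★ p764344):
`hvan` — `Ext¹(𝒪_{X₀}, 𝒪_Z(d)|_{X₀}) = 0`; `hrank` — `dim_K Γ(X₀, 𝒪_Z(d)|_{X₀}) = r`; `hspan` — the restricted `η(q_j)` SPAN
`Γ(X₀, 𝒪_Z(d)|_{X₀})` over `K` (for a flat family with fibrewise Hilbert polynomial `P` and `d ≥ d₀(P)`, `r = P(d)`, these are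
Mumford's uniform regularity ★ `regular_quot_of_hilbertPolynomial_projectiveSpace` read on the fibre — NOT in this file), and the
generic Nakayama-for-sheaves input `hLc` («fibrewise surjective at every field point ⇒ epimorphism onto a finite locally free module»,
the L-c brick `Modules/EpiOfFibrewiseSurjective` of B-p16 (g16), here a HYPOTHESIS BINDER in its exact letter until it is ★).

* **`existsUnique_hom_grassmannian_of_forall_fieldPoint`** — THEN there is a UNIQUE morphism `g : T ⟶ grassmannianScheme M r` whose
  value on every affine open `V ⊆ T` is the quotient `Γ(Q_d, V)` of `Γ(T, V) ⊗ M` (`evalAffine V (pointsEquiv g) = ker θ_V`, ★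
  `Grassmannian.existsUnique_hom_ker_sectionsMap` / `existsUnique_hom_of_epi`): the sections `q_j` define `ψ : 𝒪_T^{(J)} ⟶ Q_d` (★
  `exists_hom_freeModule_app_eq`); at a field point `x`, the base-change ISOMORPHISM `x^* Q_d ≅ (f₀)_* (𝒪_Z(d)|_{X₀})` of ★ FILE α
  (`isIso_pushforwardBaseChangeHom_twistMod_of_forall_fieldPoint`, formula ★ `pushforwardBaseChangeHom_app_unitSectionLE`) carries
  `x^*ψ(η_x ε_j)` to `η_k(q_j)`, so `hspan` makes `x^*ψ` onto (`pullback_map_app_top_surjective_of_span`); `hLc` gives `Epi ψ`; `Q_d`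
  has rank `r` by ★ FILE α; conclude by ★ `existsUnique_hom_of_epi` (★ `freeModuleFrame`, `basisSection_freeModuleFrame`).

Count-neutral capital (`--supports stmt-HodgeConjecture-24835`); HC_CM is proved only modulo the 7 printed citations until rung 0 closes,
and this file discharges none of them.

## References
* [Mumford1966CurvesSurface] D. Mumford, *Lectures on Curves on an Algebraic Surface* (1966), Lecture 15 (II.)–(III.).
* [GortzWedhorn2020] U. Görtz, T. Wedhorn, *Algebraic Geometry I*, 2nd ed. (2020), (8.4) (pp. 213–215) (the Grassmannian functor).
* [Hartshorne1977] R. Hartshorne, *Algebraic Geometry* (1977), II §5 p. 110 (`f^* ⊣ f_*`), III Prop. 9.3 (Remark 9.3.1).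
-/

noncomputable section

-- `TopCat.Presheaf`/`Scheme.Modules` are not reducible (as in Mathlib's `AlgebraicGeometry/Modules/Sheaf.lean`).
set_option backward.isDefEq.respectTransparency false

open CategoryTheory CategoryTheory.Limits CategoryTheory.Abelian AlgebraicGeometry TopologicalSpace Opposite TensorProduct

namespace Literature.AlgebraicGeometry.Motives

open Literature.AlgebraicGeometry.Modules Literature.AlgebraicGeometry.Motives.Grassmannian

/-! ### §1 Surjectivity of `x^*ψ` on global sections from a span condition behind a base-change isomorphism -/

section Surjective

variable {T X X₀ : Scheme.{0}} {p : X ⟶ T} {K : Type} [Field K] {k : X₀ ⟶ X} {f₀ : X₀ ⟶ Spec (CommRingCat.of K)}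
  {x : Spec (CommRingCat.of K) ⟶ T} (H : IsPullback k f₀ p x) (G : X.Modules)
  {J : Type} (ψ : freeModule T J ⟶ (Scheme.Modules.pushforward p).obj G)

include H in
/-- **`x^*ψ` is onto on global sections** when the base-change morphism `β : x^*(p_* G) ⟶ (f₀)_*(k^* G)` is an isomorphism and the
restricted sections `η_k(ψ(ε_j))` span `Γ(X₀, k^* G)` over `K`: a preimage of `τ` is `Σ_j c_j · η_x(ε_j)` where
`β(τ) = Σ_j c_j · η_k(ψ(ε_j))` (★ `pullback_map_app_unitSectionLE`, ★ `pushforwardBaseChangeHom_app_unitSectionLE`).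
[cite: Hartshorne1977, III Prop. 9.3 (Remark 9.3.1)] [cite: StacksProject, Tag 02N6] -/
theorem pullback_map_app_top_surjective_of_span [IsIso (pushforwardBaseChangeHom H.w G)]
    (hspan : ∀ σ : Γ((Scheme.Modules.pullback k).obj G, ⊤),
      SecMod.mk (L := (Scheme.Modules.pullback k).obj G) (ρ := f₀.appTop.hom) (U := ⊤) σ ∈
        Submodule.span Γ(Spec (CommRingCat.of K), ⊤) (Set.range fun j : J ↦
          SecMod.mk (L := (Scheme.Modules.pullback k).obj G) (ρ := f₀.appTop.hom) (U := ⊤)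
            (unitSectionLE k G (V := ⊤) (U := ⊤) le_top
              (ψ.app ⊤ (freeSectionOn T j ⊤))))) :
    Function.Surjective (((Scheme.Modules.pullback x).map ψ).app ⊤) := by
  classical
  -- notation: `β : x^*(p_*G) ⟶ (f₀)_*(k^*G)` (an isomorphism), `N₀ := k^*G`, the composite `Λ = β ∘ x^*ψ` on `Γ(⊤)`
  set β := pushforwardBaseChangeHom H.w G with hβ
  have htoS : ∀ a : Γ(Spec (CommRingCat.of K), ⊤), toSections f₀.appTop.hom ⊤ a = f₀.appTop a := by
    intro a
    have e1 : (homOfLE (le_top : (⊤ : X₀.Opens) ≤ ⊤)) = 𝟙 ⊤ := Subsingleton.elim _ _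
    change X₀.presheaf.map (homOfLE le_top).op (f₀.appTop a) = _
    rw [e1, op_id, CategoryTheory.Functor.map_id]
    rfl
  -- the sections `σ ∈ Γ(k^*G, ⊤)` of the form `β(x^*ψ(ξ))` form a `Γ(Spec K, 𝒪)`-submodule
  let S : Submodule Γ(Spec (CommRingCat.of K), ⊤)
      (SecMod ((Scheme.Modules.pullback k).obj G) f₀.appTop.hom (⊤ : X₀.Opens)) :=
    { carrier := {σ | ∃ ξ : Γ((Scheme.Modules.pullback x).obj (freeModule T J), ⊤),
        (show Γ((Scheme.Modules.pullback k).obj G, ⊤) from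
          β.app ⊤ (((Scheme.Modules.pullback x).map ψ).app ⊤ ξ)) =
          SecMod.val (L := (Scheme.Modules.pullback k).obj G) (ρ := f₀.appTop.hom) σ}
      zero_mem' := ⟨0, by rw [map_zero, map_zero]; rfl⟩
      add_mem' := by
        rintro σ σ' ⟨ξ, hξ⟩ ⟨ξ', hξ'⟩
        refine ⟨ξ + ξ', ?_⟩
        rw [map_add, map_add, SecMod.val_add, ← hξ, ← hξ']
      smul_mem' := by
        rintro a σ ⟨ξ, hξ⟩
        refine ⟨a • ξ, ?_⟩
        rw [Scheme.Modules.Hom.app_smul, Scheme.Modules.Hom.app_smul, SecMod.smul_def, htoS, ← hξ]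
        rfl }
  -- it contains the generators `η_k(ψ ε_j)`: `β(x^*ψ(η_x ε_j)) = β(η_x(ψ ε_j)) = η_k(ψ ε_j)`
  have hgen : ∀ j : J, SecMod.mk (L := (Scheme.Modules.pullback k).obj G) (ρ := f₀.appTop.hom) (U := ⊤)
      (unitSectionLE k G (V := ⊤) (U := ⊤) le_top (ψ.app ⊤ (freeSectionOn T j ⊤))) ∈ S := by
    intro j
    have h := pushforwardBaseChangeHom_app_unitSectionLE H.w G (V := ⊤) (W := ⊤) le_top
      (ψ.app ⊤ (freeSectionOn T j ⊤))
    refine ⟨unitSectionLE x (freeModule T J) (V := ⊤) (U := ⊤) le_top (freeSectionOn T j ⊤), ?_⟩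
    rw [pullback_map_app_unitSectionLE, h]
    rfl
  -- hence it is everything (`hspan`)
  have hS : ∀ σ, σ ∈ S := fun σ => (Submodule.span_le.mpr (Set.range_subset_iff.mpr hgen)) (hspan (SecMod.val σ))
  -- conclude: `β` is injective on global sections
  intro τ
  obtain ⟨ξ, hξ⟩ := hS (SecMod.mk (L := (Scheme.Modules.pullback k).obj G) (ρ := f₀.appTop.hom) (U := ⊤)
    (show Γ((Scheme.Modules.pullback k).obj G, ⊤) from β.app ⊤ τ))
  haveI : IsIso (β.app ⊤) := inferInstance
  exact ⟨ξ, (ConcreteCategory.bijective_of_isIso (β.app ⊤)).1 hξ⟩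

end Surjective


/-! ### §2 The `T`-point of the Grassmannian of a flat closed family `Z ⊂ 𝐏(ι; T)` -/

section Point

variable {ι : Type} {T Z : Scheme.{0}} [IsLocallyNoetherian T] (i : Z ⟶ Morphisms.projectiveSpace ι T) [IsClosedImmersion i]
  [Flat (i ≫ Morphisms.projectiveSpaceFst ι T)] (d r : ℕ)
  {J : Type} [Fintype J] {M : Type} [AddCommGroup M] (b : Module.Basis J ℤ M)
  [(grassmannianSheaf M r).obj.IsRepresentable]
  (q : J → Γ(SerreTwist.twistMod (i ≫ pullback.snd (terminal.from T) (terminal.from (Morphisms.projectiveSpaceInt ι)))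
    (unitModule Z) d, ⊤))

/-- **Lect. 15 (II.)–(III.): a FLAT closed family `Z ⊂ 𝐏(ι; T)` with fibrewise `Ext¹ = 0`, `h⁰ = r` and fibrewise spanning
sections `q_j ∈ Γ(Z, 𝒪_Z(d))` defines a UNIQUE `T`-point `g : T ⟶ grassmannianScheme M r`** whose value on every affine open
`V ⊆ T` is the rank-`r` quotient `Γ((p_Z)_* 𝒪_Z(d), V)` of `Γ(T, V) ⊗ M` («This is an `S`-valued point of the Grassmannian!»):
the `q_j` define `ψ : 𝒪_T^{(J)} ⟶ (p_Z)_* 𝒪_Z(d)` (★ `exists_hom_freeModule_app_eq`), onto at every field point by §1 over the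
base-change isomorphism of ★ FILE α, hence an epimorphism (★ `epi_of_forall_fieldPoint_app_top_surjective_of_isFiniteLocallyFree'`,
Nakayama for sheaves), onto a module of rank `r` (★ FILE α); ★ `Grassmannian.existsUnique_hom_of_epi` concludes.
[cite: Mumford1966CurvesSurface, Lecture 15 (II.)] [cite: GortzWedhorn2020, (8.4) (pp. 213–215)] [cite: StacksProject, Tag 089R] -/
theorem existsUnique_hom_grassmannian_of_forall_fieldPoint
    (hvan : ∀ ⦃K : Type⦄ [Field K] ⦃X₀ : Scheme.{0}⦄ (k : X₀ ⟶ Z) (f₀ : X₀ ⟶ Spec (CommRingCat.of K))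
      (x : Spec (CommRingCat.of K) ⟶ T), IsPullback k f₀ (i ≫ Morphisms.projectiveSpaceFst ι T) x →
        Subsingleton (Ext.{1} (unitModule X₀) ((Scheme.Modules.pullback k).obj
          (SerreTwist.twistMod (i ≫ pullback.snd (terminal.from T) (terminal.from (Morphisms.projectiveSpaceInt ι)))
            (unitModule Z) d)) 1))
    (hrank : ∀ ⦃K : Type⦄ [Field K] ⦃X₀ : Scheme.{0}⦄ (k : X₀ ⟶ Z) (f₀ : X₀ ⟶ Spec (CommRingCat.of K))
      (x : Spec (CommRingCat.of K) ⟶ T), IsPullback k f₀ (i ≫ Morphisms.projectiveSpaceFst ι T) x →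
        Module.finrank Γ(Spec (CommRingCat.of K), ⊤) (SecMod ((Scheme.Modules.pullback k).obj
          (SerreTwist.twistMod (i ≫ pullback.snd (terminal.from T) (terminal.from (Morphisms.projectiveSpaceInt ι)))
            (unitModule Z) d)) f₀.appTop.hom ⊤) = r)
    (hspan : ∀ ⦃K : Type⦄ [Field K] ⦃X₀ : Scheme.{0}⦄ (k : X₀ ⟶ Z) (f₀ : X₀ ⟶ Spec (CommRingCat.of K))
      (x : Spec (CommRingCat.of K) ⟶ T), IsPullback k f₀ (i ≫ Morphisms.projectiveSpaceFst ι T) x →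
        ∀ σ : Γ((Scheme.Modules.pullback k).obj
          (SerreTwist.twistMod (i ≫ pullback.snd (terminal.from T) (terminal.from (Morphisms.projectiveSpaceInt ι)))
            (unitModule Z) d), ⊤),
          SecMod.mk (L := (Scheme.Modules.pullback k).obj
              (SerreTwist.twistMod (i ≫ pullback.snd (terminal.from T) (terminal.from (Morphisms.projectiveSpaceInt ι)))
                (unitModule Z) d)) (ρ := f₀.appTop.hom) (U := ⊤) σ ∈
            Submodule.span Γ(Spec (CommRingCat.of K), ⊤) (Set.range fun j ↦
              SecMod.mk (L := (Scheme.Modules.pullback k).obj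
                (SerreTwist.twistMod (i ≫ pullback.snd (terminal.from T) (terminal.from (Morphisms.projectiveSpaceInt ι)))
                  (unitModule Z) d)) (ρ := f₀.appTop.hom) (U := ⊤)
                (unitSectionLE k _ (V := ⊤) (U := ⊤) le_top (q j)))) :
    ∃! g : T ⟶ grassmannianScheme M r, ∀ V : T.affineOpens,
      (evalAffine V.2 (pointsEquiv M r T g)).toSubmodule =
        LinearMap.ker (sectionsMap b ((Scheme.Modules.pushforward (i ≫ Morphisms.projectiveSpaceFst ι T)).obj
          (SerreTwist.twistMod (i ≫ pullback.snd (terminal.from T) (terminal.from (Morphisms.projectiveSpaceInt ι)))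
            (unitModule Z) d)) q V) := by
  classical
  have hQ : HasRank ((Scheme.Modules.pushforward (i ≫ Morphisms.projectiveSpaceFst ι T)).obj
      (SerreTwist.twistMod (i ≫ pullback.snd (terminal.from T) (terminal.from (Morphisms.projectiveSpaceInt ι)))
        (unitModule Z) d)) r :=
    hasRank_pushforward_twistMod_of_forall_fieldPoint i d r hvan hrank
  -- the morphism `ψ : 𝒪_T^{(J)} ⟶ (p_Z)_* 𝒪_Z(d)` with `ψ(ε_j) = q_j`
  obtain ⟨ψ, hψ⟩ := exists_hom_freeModule_app_eq (T := T)
    ((Scheme.Modules.pushforward (i ≫ Morphisms.projectiveSpaceFst ι T)).obj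
      (SerreTwist.twistMod (i ≫ pullback.snd (terminal.from T) (terminal.from (Morphisms.projectiveSpaceInt ι)))
        (unitModule Z) d)) q
  have hψtop : ∀ j, ψ.app ⊤ (freeSectionOn T j ⊤) = q j := fun j => by
    rw [hψ]
    have e1 : (homOfLE (le_top : (⊤ : T.Opens) ≤ ⊤)) = 𝟙 ⊤ := Subsingleton.elim _ _
    rw [e1, op_id, CategoryTheory.Functor.map_id]
    rfl
  -- `ψ` is onto at every field point (§1 behind FILE α's base-change isomorphism), hence an epimorphism (Nakayama for sheaves)
  haveI : Epi ψ := by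
    refine epi_of_forall_fieldPoint_app_top_surjective_of_isFiniteLocallyFree' ψ (HasRank.isFiniteLocallyFree' hQ)
      fun K _ x => ?_
    have Hsq : IsPullback (pullback.fst (i ≫ Morphisms.projectiveSpaceFst ι T) x)
        (pullback.snd (i ≫ Morphisms.projectiveSpaceFst ι T) x) (i ≫ Morphisms.projectiveSpaceFst ι T) x :=
      IsPullback.of_hasPullback _ x
    haveI : IsIso (pushforwardBaseChangeHom Hsq.w
        (SerreTwist.twistMod (i ≫ pullback.snd (terminal.from T) (terminal.from (Morphisms.projectiveSpaceInt ι)))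
          (unitModule Z) d)) :=
      isIso_pushforwardBaseChangeHom_twistMod_of_forall_fieldPoint i d hvan Hsq
    refine pullback_map_app_top_surjective_of_span Hsq _ ψ fun σ => ?_
    have hs := hspan _ _ _ Hsq σ
    have hfamj : (fun j : J => SecMod.mk (L := (Scheme.Modules.pullback (pullback.fst (i ≫ Morphisms.projectiveSpaceFst ι T) x)).obj
          (SerreTwist.twistMod (i ≫ pullback.snd (terminal.from T) (terminal.from (Morphisms.projectiveSpaceInt ι)))
            (unitModule Z) d)) (ρ := (pullback.snd (i ≫ Morphisms.projectiveSpaceFst ι T) x).appTop.hom) (U := ⊤)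
          (unitSectionLE (pullback.fst (i ≫ Morphisms.projectiveSpaceFst ι T) x) _ (V := ⊤) (U := ⊤) le_top
            (ψ.app ⊤ (freeSectionOn T j ⊤)))) =
        fun j : J => SecMod.mk (L := (Scheme.Modules.pullback (pullback.fst (i ≫ Morphisms.projectiveSpaceFst ι T) x)).obj
          (SerreTwist.twistMod (i ≫ pullback.snd (terminal.from T) (terminal.from (Morphisms.projectiveSpaceInt ι)))
            (unitModule Z) d)) (ρ := (pullback.snd (i ≫ Morphisms.projectiveSpaceFst ι T) x).appTop.hom) (U := ⊤)
          (unitSectionLE (pullback.fst (i ≫ Morphisms.projectiveSpaceFst ι T) x) _ (V := ⊤) (U := ⊤) le_top (q j)) :=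
      funext fun j => by rw [hψtop]
    rw [hfamj]
    exact hs
  -- conclude by the universal property of the Grassmannian
  have h := Grassmannian.existsUnique_hom_of_epi M r b
    ((Scheme.Modules.pushforward (i ≫ Morphisms.projectiveSpaceFst ι T)).obj
      (SerreTwist.twistMod (i ≫ pullback.snd (terminal.from T) (terminal.from (Morphisms.projectiveSpaceInt ι)))
        (unitModule Z) d)) (freeModuleFrame T J ⊤) ψ (isAffineLocalizing_freeModule T J) hQ
  have hfam : (fun j => ψ.app ⊤ (basisSection (E := freeModule T J) (freeModuleFrame T J ⊤) j)) = q :=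
    funext fun j => by rw [basisSection_freeModuleFrame, hψtop]
  rw [hfam] at h
  exact h

end Point

end Literature.AlgebraicGeometry.Motives

end
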